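import Summits.CriticalPhenomena.SAWScalingLimit.Theorems.SAWDefectDecoherenceObservableToSLERCarvedReductionSqueezeLegsPrep
import HarnessLib

/-!
# Two legs in one corridor make a window cross-cut (piece (M1a) of stub 5a4″
# `stub_carvedReduction_squeezeSolid`, part 2 of 2)

Piece of stub 5a4″ `stub_carvedReduction_squeezeSolid`
(`TwoPieceAdmRestrictionLimit → MovingCarvingSqueezeP FatAnchoredClassZeroSolid`) of the line
`bridge-gate-renewal` (r10) of the crux `SAWDefectDecoherence.ObservableToSLER`
(stmt-CriticalPhenomena-14005; twin T2b″ of stmt-CriticalPhenomena-10472).  The common two-piece flat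
super-domain `E` of the moving-carving squeeze is cut out of a Jordan domain `J` by two window
cross-cuts (`stub_carvedReduction_superDomainOfCrosscuts`, p133663); this file PRODUCES such a
cross-cut from the data the limit configuration supplies:

* a window: the closed gate ball `closedBall g ρ ⊆ J`, its horizontal diameter
  `[g - ρ, g + ρ]` and the two vertical DOCKS of length `ρ/2` hanging from the diameter ends;
* a CORRIDOR `O`: an open connected subset of `J` off the closed gate ball containing both docks
  (but their tops) — in the squeeze, the lattice-free zone (lower window region, spine tubes,
  collar patch);
* an EXIT: a cross-cut `η` of `J` from `x 0` to `x 1` running, but for its endpoints, inside the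
  corridor and off the docks — in the squeeze, a short in–across–out arc in the collar patch.

`stub_carvedReduction_legsToCrosscut`: then there is a cross-cut `L` of `J` from `x 0` to `x 1`
containing the diameter, contained in `O ∪ [g - ρ, g + ρ] ∪ {x 0, x 1}`, and meeting the closed
gate ball exactly in the diameter.  (No "two disjoint lanes" hypothesis on the corridor is
needed, and the exit may be met by the legs in either order.)

Proof ("the second leg exists for one of the two orientations of the exit"): the first leg is a
simple arc of `O` off the right dock (an end-cut of `O`: non-separating) from the left dock bottom
to `η`, trimmed at its first point `p₀` of `η` and then at its last point `p_L` of the left dock;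
with the dock piece `[g - ρ, p_L]` it is an END-CUT `A'` of `O` (it meets `Oᶜ` in the dock top
only), so `O ∖ A'` is connected (`exists_isSimpleArc_diff`); the second leg is a simple arc of
`O ∖ A'` from the right dock bottom to a point of `η` other than `p₀`, trimmed likewise, reaching
`η` at `z' ≠ p₀` and the right dock at `p_R`; the cross-cut is
`η[x 0, p₀] + leg + [p_L, g - ρ] + diameter + [g + ρ, p_R] + leg + η[z', x 1]`, or the same with
the two ends of `η` exchanged, according to the order of `p₀, z'` along `η`
(`isSimpleArc_glue_five`).

Sources: M. H. A. Newman, Elements of the topology of plane sets of points (1939), Ch. V §11;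
Ch. Pommerenke, Boundary Behaviour of Conformal Maps (1992) §1.1 (Janiszewski).
-/

noncomputable section
open scoped Topology
open Filter Set Metric
open Literature.Probability.RandomPlanarGeometry
open Literature.Topology.PlaneTopology

namespace Summit.CriticalPhenomena.SAWScalingLimit.Theorems.ObservableToSLER.Squeeze

/-! ### The cross-cut -/

/-- **Registered sub-goal `stub_carvedReduction_legsToCrosscut`** (crux item stmt-CriticalPhenomena-14005,
stub 5a4″ `stub_carvedReduction_squeezeSolid`, piece (M1a) TWO LEGS IN ONE CORRIDOR MAKE A WINDOW
CROSS-CUT; the input of `stub_carvedReduction_superDomainOfCrosscuts`).  Let `J` be a Jordan domain,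
`closedBall g ρ ⊆ J` a closed gate ball, `O ⊆ J` an open connected CORRIDOR off the closed gate
ball containing the two docks `[g ∓ ρ, g ∓ ρ - (ρ/2) i]` but their tops, and `η` a cross-cut of
`J` from `x 0` to `x 1` inside `O` (but for its endpoints) and off the docks.  Then there is a
cross-cut `L` of `J` from `x 0` to `x 1` containing the diameter `[g - ρ, g + ρ]`, contained in
`O ∪ [g - ρ, g + ρ] ∪ {x 0, x 1}`, with `L ∩ closedBall g ρ = [g - ρ, g + ρ]`. -/
theorem stub_carvedReduction_legsToCrosscut :
    ∀ (J : JordanDomain) (g : ℂ) (ρ : ℝ) (O η : Set ℂ) (x : Fin 2 → ℂ),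
      0 < ρ → closedBall g ρ ⊆ J.carrier → IsOpen O → IsConnected O → O ⊆ J.carrier →
      Disjoint O (closedBall g ρ) →
      segment ℝ (g - ρ) (g - ρ - ((ρ / 2 : ℝ) : ℂ) * Complex.I) \ {g - ρ} ⊆ O →
      segment ℝ (g + ρ) (g + ρ - ((ρ / 2 : ℝ) : ℂ) * Complex.I) \ {g + ρ} ⊆ O →
      J.IsCrosscut η (x 0) (x 1) → η \ {x 0, x 1} ⊆ O →
      Disjoint η (segment ℝ (g - ρ) (g - ρ - ((ρ / 2 : ℝ) : ℂ) * Complex.I)) →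
      Disjoint η (segment ℝ (g + ρ) (g + ρ - ((ρ / 2 : ℝ) : ℂ) * Complex.I)) →
      ∃ L : Set ℂ, J.IsCrosscut L (x 0) (x 1) ∧ segment ℝ (g - ρ) (g + ρ) ⊆ L ∧
        L ⊆ O ∪ segment ℝ (g - ρ) (g + ρ) ∪ {x 0, x 1} ∧
        L ∩ closedBall g ρ = segment ℝ (g - ρ) (g + ρ) := by
  intro J g ρ O η x hρ hballJ hOo hOc hOJ hOball hdockL hdockR hη hηO hηdL hηdR
  -- notation
  set tL : ℂ := g - ρ with htL
  set tR : ℂ := g + ρ with htR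
  set dockL : Set ℂ := segment ℝ tL (tL - ((ρ / 2 : ℝ) : ℂ) * Complex.I) with hdockLdef
  set dockR : Set ℂ := segment ℝ tR (tR - ((ρ / 2 : ℝ) : ℂ) * Complex.I) with hdockRdef
  set diam : Set ℂ := segment ℝ tL tR with hdiamdef
  set bL : ℂ := tL - ((ρ / 2 : ℝ) : ℂ) * Complex.I with hbL
  set bR : ℂ := tR - ((ρ / 2 : ℝ) : ℂ) * Complex.I with hbR
  obtain ⟨hηarc, hx0, hx1, hx01, hηJ⟩ := hη
  obtain ⟨γ, hγc, hγi, hγη, hγ0, hγ1⟩ := isSimpleArc_iff_continuous.1 hηarc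
  -- basic facts
  have hOb : Bornology.IsBounded O := J.isBounded.subset hOJ
  have hxJ : ∀ k, x k ∉ J.carrier := by
    intro k hk
    have hfr : x k ∈ frontier J.carrier := by fin_cases k <;> assumption
    rw [J.isOpen.frontier_eq] at hfr
    exact hfr.2 hk
  have hxO : ∀ k, x k ∉ O := fun k hk => hxJ k (hOJ hk)
  have hxball : ∀ k, x k ∉ closedBall g ρ := fun k hk => hxJ k (hballJ hk)
  have htLre : tL.re = g.re - ρ := by simp [htL]
  have htRre : tR.re = g.re + ρ := by simp [htR]
  have htLim : tL.im = g.im := by simp [htL]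
  have htRim : tR.im = g.im := by simp [htR]
  have htLball : tL ∈ closedBall g ρ := by
    rw [mem_closedBall, dist_eq_norm, htL, show g - ρ - g = -(ρ : ℂ) by ring, norm_neg,
      Complex.norm_real, Real.norm_eq_abs, abs_of_pos hρ]
  have htRball : tR ∈ closedBall g ρ := by
    rw [mem_closedBall, dist_eq_norm, htR, show g + ρ - g = (ρ : ℂ) by ring,
      Complex.norm_real, Real.norm_eq_abs, abs_of_pos hρ]
  have htLO : tL ∉ O := fun h => Set.disjoint_left.1 hOball h htLball
  have htRO : tR ∉ O := fun h => Set.disjoint_left.1 hOball h htRball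
  have hdiam_ball : diam ⊆ closedBall g ρ := (convex_closedBall g ρ).segment_subset htLball htRball
  have htLdiam : tL ∈ diam := left_mem_segment ℝ tL tR
  have htRdiam : tR ∈ diam := right_mem_segment ℝ tL tR
  have htLtR : tL ≠ tR := fun h => by
    have := congrArg Complex.re h; rw [htLre, htRre] at this; linarith
  have hv0 : ((ρ / 2 : ℝ) : ℂ) * Complex.I ≠ 0 :=
    mul_ne_zero (Complex.ofReal_ne_zero.2 (by positivity)) Complex.I_ne_zero
  have hbLtL : bL ≠ tL := fun h => hv0 (by rw [hbL] at h; linear_combination -h)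
  have hbRtR : bR ≠ tR := fun h => hv0 (by rw [hbR] at h; linear_combination -h)
  have hbLdock : bL ∈ dockL := right_mem_segment ℝ _ _
  have hbRdock : bR ∈ dockR := right_mem_segment ℝ _ _
  have hbLO : bL ∈ O := hdockL ⟨hbLdock, hbLtL⟩
  have hbRO : bR ∈ O := hdockR ⟨hbRdock, hbRtR⟩
  -- docks: abscissae, disjointness, intersections with the diameter
  have hdockLre : ∀ z ∈ dockL, z.re = g.re - ρ := fun z hz => (mem_dock hρ hz).1.trans htLre
  have hdockRre : ∀ z ∈ dockR, z.re = g.re + ρ := fun z hz => (mem_dock hρ hz).1.trans htRre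
  have hdockLR : Disjoint dockL dockR := Set.disjoint_left.2 fun z hzL hzR => by
    have h1 := hdockLre z hzL; have h2 := hdockRre z hzR; linarith
  have hdockLdiam : dockL ∩ diam ⊆ {tL} := fun z ⟨hzd, hzm⟩ =>
    (mem_dock hρ hzd).2.2 ((im_eq_of_mem_diameter hzm).trans htLim.symm)
  have hdockRdiam : dockR ∩ diam ⊆ {tR} := fun z ⟨hzd, hzm⟩ =>
    (mem_dock hρ hzd).2.2 ((im_eq_of_mem_diameter hzm).trans htRim.symm)
  have hdockLO : dockL \ O = {tL} := by
    refine Subset.antisymm (fun z ⟨hz, hzO⟩ => ?_) ?_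
    · by_contra hne
      exact hzO (hdockL ⟨hz, hne⟩)
    · rintro z rfl
      exact ⟨left_mem_segment ℝ _ _, htLO⟩
  have hdockRO : dockR \ O = {tR} := by
    refine Subset.antisymm (fun z ⟨hz, hzO⟩ => ?_) ?_
    · by_contra hne
      exact hzO (hdockR ⟨hz, hne⟩)
    · rintro z rfl
      exact ⟨left_mem_segment ℝ _ _, htRO⟩
  have hdockLsubO : dockL ⊆ O ∪ {tL} := fun z hz => by
    by_cases h : z = tL
    · exact Or.inr h
    · exact Or.inl (hdockL ⟨hz, h⟩)
  have hdockRsubO : dockR ⊆ O ∪ {tR} := fun z hz => by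
    by_cases h : z = tR
    · exact Or.inr h
    · exact Or.inl (hdockR ⟨hz, h⟩)
  -- the exit
  have hηOx : η ⊆ O ∪ {x 0, x 1} := fun z hz => by
    by_cases h : z ∈ ({x 0, x 1} : Set ℂ)
    · exact Or.inr h
    · exact Or.inl (hηO ⟨hz, h⟩)
  have hηball : Disjoint η (closedBall g ρ) := Set.disjoint_left.2 fun z hz hzb => by
    rcases hηOx hz with h | h
    · exact Set.disjoint_left.1 hOball h hzb
    · rcases h with rfl | h
      · exact hxball 0 hzb
      · exact hxball 1 (mem_singleton_iff.1 h ▸ hzb)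
  have hηdiam : Disjoint diam η := Set.disjoint_left.2 fun z hz hzη =>
    Set.disjoint_left.1 hηball hzη (hdiam_ball hz)
  have hγmem : ∀ t ∈ Icc (0 : ℝ) 1, γ t ∈ η := fun t ht => hγη ▸ ⟨t, ht, rfl⟩
  have hγO : ∀ t, 0 < t → t < 1 → γ t ∈ O := by
    intro t ht0 ht1
    refine hηO ⟨hγmem t ⟨ht0.le, ht1.le⟩, ?_⟩
    rintro (h | h)
    · rw [← hγ0] at h
      have := hγi ⟨ht0.le, ht1.le⟩ ⟨le_rfl, zero_le_one⟩ h
      exact ht0.ne' this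
    · rw [mem_singleton_iff, ← hγ1] at h
      have := hγi ⟨ht0.le, ht1.le⟩ ⟨zero_le_one, le_rfl⟩ h
      exact ht1.ne this
  have hηcl : IsClosed η := hηarc.isCompact.isClosed
  -- STEP A: the first leg, in `O` off the right dock, from the left dock bottom to `η`
  have hdockRarc : IsSimpleArc dockR tR bR := IsSimpleArc.segment hbRtR.symm
  have hdockRc : IsCompact dockR := hdockRarc.isCompact
  have hbLdockR : bL ∉ dockR := fun h => Set.disjoint_left.1 hdockLR hbLdock h
  set y : ℂ := γ (1 / 2) with hy
  have hyη : y ∈ η := hγmem _ ⟨by norm_num, by norm_num⟩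
  have hyO : y ∈ O := hγO _ (by norm_num) (by norm_num)
  have hydockR : y ∉ dockR := fun h => Set.disjoint_left.1 hηdR hyη h
  have hbLη : bL ∉ η := fun h => Set.disjoint_left.1 hηdL h hbLdock
  have hbLy : bL ≠ y := fun h => hbLη (h ▸ hyη)
  obtain ⟨α₀, hα₀sub, hα₀⟩ := exists_isSimpleArc_diff hOo hOc hOb hdockRc hdockRarc.isConnected_compl
    (by rw [hdockRO]; exact isPreconnected_singleton) ⟨hbLO, hbLdockR⟩ ⟨hyO, hydockR⟩ hbLy
  obtain ⟨α₁, p₀, hα₁sub, hα₁, hα₁η, -⟩ := hα₀.exists_subarc_of_isClosed hηcl hbLη hyη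
  have hp₀α₁ : p₀ ∈ α₁ := hα₁.right_mem
  have hp₀η : p₀ ∈ η := by
    have : p₀ ∈ α₁ ∩ η := by rw [hα₁η]; exact rfl
    exact this.2
  have hα₁O : α₁ ⊆ O := fun z hz => (hα₀sub (hα₁sub hz)).1
  have hp₀O : p₀ ∈ O := hα₁O hp₀α₁
  have hp₀dockL : p₀ ∉ dockL := fun h => Set.disjoint_left.1 hηdL hp₀η h
  have hdockLcl : IsClosed dockL := (IsSimpleArc.segment hbLtL.symm).isCompact.isClosed
  obtain ⟨α', pL, hα'sub, hα', hα'dockL, -⟩ := hα₁.symm.exists_subarc_of_isClosed hdockLcl hp₀dockL hbLdock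
  have hpLα' : pL ∈ α' := hα'.right_mem
  have hp₀α' : p₀ ∈ α' := hα'.left_mem
  have hpLdockL : pL ∈ dockL := by
    have : pL ∈ α' ∩ dockL := by rw [hα'dockL]; exact rfl
    exact this.2
  have hα'O : α' ⊆ O := fun z hz => hα₁O (hα'sub hz)
  have hpLO : pL ∈ O := hα'O hpLα'
  have hpLtL : pL ≠ tL := fun h => htLO (h ▸ hpLO)
  have hα'dockR : Disjoint α' dockR :=
    Set.disjoint_left.2 fun z hz hzR => (hα₀sub (hα₁sub (hα'sub hz))).2 hzR
  have hα'η : α' ∩ η = {p₀} := by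
    refine Subset.antisymm (fun z hz => ?_) ?_
    · have : z ∈ α₁ ∩ η := ⟨hα'sub hz.1, hz.2⟩
      rwa [hα₁η] at this
    · rintro z rfl; exact ⟨hp₀α', hp₀η⟩
  set cL : Set ℂ := segment ℝ tL pL with hcLdef
  have hcLsub : cL ⊆ dockL := (convex_segment _ _).segment_subset (left_mem_segment ℝ _ _) hpLdockL
  have hcLarc : IsSimpleArc cL tL pL := IsSimpleArc.segment hpLtL.symm
  have htLcL : tL ∈ cL := left_mem_segment ℝ _ _
  have hcLα' : cL ∩ α' ⊆ {pL} := fun z ⟨hzc, hza⟩ => by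
    have : z ∈ α' ∩ dockL := ⟨hza, hcLsub hzc⟩
    rwa [hα'dockL] at this
  have hA' : IsSimpleArc (cL ∪ α') tL p₀ := hcLarc.union hα'.symm hcLα'
  have hA'O : (cL ∪ α') \ O = {tL} := by
    refine Subset.antisymm ?_ ?_
    · rintro z ⟨hz | hz, hzO⟩
      · have : z ∈ dockL \ O := ⟨hcLsub hz, hzO⟩
        rwa [hdockLO] at this
      · exact (hzO (hα'O hz)).elim
    · rintro z rfl; exact ⟨Or.inl htLcL, htLO⟩
  -- STEP B: the second leg, in `O` off the end-cut `cL ∪ α'`, from the right dock bottom to `η`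
  obtain ⟨z₀, hz₀η, hz₀O, hz₀p₀⟩ : ∃ z₀, z₀ ∈ η ∧ z₀ ∈ O ∧ z₀ ≠ p₀ := by
    by_cases h : γ (1 / 3) = p₀
    · refine ⟨γ (2 / 3), hγmem _ ⟨by norm_num, by norm_num⟩, hγO _ (by norm_num) (by norm_num), ?_⟩
      rw [← h]
      intro h'
      have := hγi ⟨by norm_num, by norm_num⟩ ⟨by norm_num, by norm_num⟩ h'
      norm_num at this
    · exact ⟨γ (1 / 3), hγmem _ ⟨by norm_num, by norm_num⟩, hγO _ (by norm_num) (by norm_num), h⟩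
  have hbRA' : bR ∉ cL ∪ α' := by
    rintro (h | h)
    · exact Set.disjoint_left.1 hdockLR (hcLsub h) hbRdock
    · exact Set.disjoint_left.1 hα'dockR h hbRdock
  have hA'η : (cL ∪ α') ∩ η ⊆ {p₀} := by
    rintro z ⟨hz | hz, hzη⟩
    · exact (Set.disjoint_left.1 hηdL hzη (hcLsub hz)).elim
    · rw [← hα'η]; exact ⟨hz, hzη⟩
  have hz₀A' : z₀ ∉ cL ∪ α' := fun h => hz₀p₀ (hA'η ⟨h, hz₀η⟩)
  have hbRη : bR ∉ η := fun h => Set.disjoint_left.1 hηdR h hbRdock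
  have hbRz₀ : bR ≠ z₀ := fun h => hbRη (h ▸ hz₀η)
  obtain ⟨β₀, hβ₀sub, hβ₀⟩ := exists_isSimpleArc_diff hOo hOc hOb hA'.isCompact hA'.isConnected_compl
    (by rw [hA'O]; exact isPreconnected_singleton) ⟨hbRO, hbRA'⟩ ⟨hz₀O, hz₀A'⟩ hbRz₀
  obtain ⟨β₁, z', hβ₁sub, hβ₁, hβ₁η, -⟩ := hβ₀.exists_subarc_of_isClosed hηcl hbRη hz₀η
  have hz'β₁ : z' ∈ β₁ := hβ₁.right_mem
  have hz'η : z' ∈ η := by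
    have : z' ∈ β₁ ∩ η := by rw [hβ₁η]; exact rfl
    exact this.2
  have hβ₁O : β₁ ⊆ O := fun z hz => (hβ₀sub (hβ₁sub hz)).1
  have hβ₁A' : Disjoint β₁ (cL ∪ α') := Set.disjoint_left.2 fun z hz hzA => (hβ₀sub (hβ₁sub hz)).2 hzA
  have hz'O : z' ∈ O := hβ₁O hz'β₁
  have hz'p₀ : z' ≠ p₀ := fun h => Set.disjoint_left.1 hβ₁A' hz'β₁ (h ▸ Or.inr hp₀α')
  have hz'dockR : z' ∉ dockR := fun h => Set.disjoint_left.1 hηdR hz'η h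
  have hdockRcl : IsClosed dockR := hdockRc.isClosed
  obtain ⟨β', pR, hβ'sub, hβ', hβ'dockR, -⟩ := hβ₁.symm.exists_subarc_of_isClosed hdockRcl hz'dockR hbRdock
  have hpRβ' : pR ∈ β' := hβ'.right_mem
  have hz'β' : z' ∈ β' := hβ'.left_mem
  have hpRdockR : pR ∈ dockR := by
    have : pR ∈ β' ∩ dockR := by rw [hβ'dockR]; exact rfl
    exact this.2
  have hβ'O : β' ⊆ O := fun z hz => hβ₁O (hβ'sub hz)
  have hpRO : pR ∈ O := hβ'O hpRβ'
  have hpRtR : pR ≠ tR := fun h => htRO (h ▸ hpRO)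
  have hβ'A' : Disjoint β' (cL ∪ α') := Set.disjoint_left.2 fun z hz => Set.disjoint_left.1 hβ₁A' (hβ'sub hz)
  have hβ'η : β' ∩ η = {z'} := by
    refine Subset.antisymm (fun z hz => ?_) ?_
    · have : z ∈ β₁ ∩ η := ⟨hβ'sub hz.1, hz.2⟩
      rwa [hβ₁η] at this
    · rintro z rfl; exact ⟨hz'β', hz'η⟩
  set cR : Set ℂ := segment ℝ tR pR with hcRdef
  have hcRsub : cR ⊆ dockR := (convex_segment _ _).segment_subset (left_mem_segment ℝ _ _) hpRdockR
  have hcRarc : IsSimpleArc cR tR pR := IsSimpleArc.segment hpRtR.symm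
  have htRcR : tR ∈ cR := left_mem_segment ℝ _ _
  have hcRβ' : cR ∩ β' ⊆ {pR} := fun z ⟨hzc, hzb⟩ => by
    have : z ∈ β' ∩ dockR := ⟨hzb, hcRsub hzc⟩
    rwa [hβ'dockR] at this
  -- parameters of `p₀` and `z'` on `η`
  obtain ⟨s₀, hs₀I, hγs₀⟩ : ∃ s₀ ∈ Icc (0 : ℝ) 1, γ s₀ = p₀ := by
    have : p₀ ∈ γ '' Icc 0 1 := hγη ▸ hp₀η
    exact this
  obtain ⟨s₁, hs₁I, hγs₁⟩ : ∃ s₁ ∈ Icc (0 : ℝ) 1, γ s₁ = z' := by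
    have : z' ∈ γ '' Icc 0 1 := hγη ▸ hz'η
    exact this
  have hs₀0 : 0 < s₀ := by
    rcases hs₀I.1.eq_or_lt with h | h
    · exact absurd (h ▸ hγ0 : γ s₀ = x 0) (fun h' => hxO 0 (h' ▸ hγs₀ ▸ hp₀O))
    · exact h
  have hs₀1 : s₀ < 1 := by
    rcases hs₀I.2.eq_or_lt with h | h
    · exact absurd (h ▸ hγ1 : γ s₀ = x 1) (fun h' => hxO 1 (h' ▸ hγs₀ ▸ hp₀O))
    · exact h
  have hs₁0 : 0 < s₁ := by
    rcases hs₁I.1.eq_or_lt with h | h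
    · exact absurd (h ▸ hγ0 : γ s₁ = x 0) (fun h' => hxO 0 (h' ▸ hγs₁ ▸ hz'O))
    · exact h
  have hs₁1 : s₁ < 1 := by
    rcases hs₁I.2.eq_or_lt with h | h
    · exact absurd (h ▸ hγ1 : γ s₁ = x 1) (fun h' => hxO 1 (h' ▸ hγs₁ ▸ hz'O))
    · exact h
  have hs₀s₁ : s₀ ≠ s₁ := fun h => hz'p₀ (by rw [← hγs₀, ← hγs₁, h])
  -- the three middle pieces and their intersections
  have hPL : IsSimpleArc (α' ∪ cL) p₀ tL := hα'.union hcLarc.symm fun z hz => hcLα' ⟨hz.2, hz.1⟩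
  have hQR : IsSimpleArc (cR ∪ β') tR z' := hcRarc.union hβ'.symm hcRβ'
  have hM : IsSimpleArc diam tL tR := IsSimpleArc.segment htLtR
  have hPη : (α' ∪ cL) ∩ η ⊆ {p₀} := fun z hz => hA'η ⟨hz.1.symm, hz.2⟩
  have hQη : (cR ∪ β') ∩ η ⊆ {z'} := by
    rintro z ⟨hz | hz, hzη⟩
    · exact (Set.disjoint_left.1 hηdR hzη (hcRsub hz)).elim
    · rw [← hβ'η]; exact ⟨hz, hzη⟩
  have hPM : (α' ∪ cL) ∩ diam ⊆ {tL} := by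
    rintro z ⟨hz | hz, hzm⟩
    · exact (Set.disjoint_left.1 hOball (hα'O hz) (hdiam_ball hzm)).elim
    · exact hdockLdiam ⟨hcLsub hz, hzm⟩
  have hMQ : diam ∩ (cR ∪ β') ⊆ {tR} := by
    rintro z ⟨hzm, hz | hz⟩
    · exact hdockRdiam ⟨hcRsub hz, hzm⟩
    · exact (Set.disjoint_left.1 hOball (hβ'O hz) (hdiam_ball hzm)).elim
  have hPQ : Disjoint (α' ∪ cL) (cR ∪ β') := by
    refine Set.disjoint_left.2 ?_
    rintro z (hz | hz) (hz' | hz')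
    · exact Set.disjoint_left.1 hα'dockR hz (hcRsub hz')
    · exact Set.disjoint_left.1 hβ'A' hz' (Or.inr hz)
    · exact Set.disjoint_left.1 hdockLR (hcLsub hz) (hcRsub hz')
    · exact Set.disjoint_left.1 hβ'A' hz' (Or.inl hz)
  -- glue, according to the order of `p₀`, `z'` on `η`
  have key : ∃ L : Set ℂ, IsSimpleArc L (γ 0) (γ 1) ∧ diam ⊆ L ∧
      L ⊆ η ∪ (α' ∪ cL) ∪ diam ∪ (cR ∪ β') := by
    rcases lt_or_gt_of_ne hs₀s₁ with h | h
    · refine ⟨_, isSimpleArc_glue_five hγc hγi hs₀0 h hs₁1 (hγs₀.symm ▸ hPL) hM (hγs₁.symm ▸ hQR)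
        (hγη.symm ▸ hγs₀.symm ▸ hPη) (hγη.symm ▸ hγs₁.symm ▸ hQη) (hγη.symm ▸ hηdiam) hPM hMQ hPQ,
        ?_, ?_⟩
      · intro z hz; exact Or.inl (Or.inl (Or.inr hz))
      · have h1 : γ '' Icc 0 s₀ ⊆ η := hγη ▸ image_mono (Icc_subset_Icc le_rfl hs₀1.le)
        have h5 : γ '' Icc s₁ 1 ⊆ η := hγη ▸ image_mono (Icc_subset_Icc hs₁0.le le_rfl)
        rintro z ((((hz | hz) | hz) | hz) | hz)
        · exact Or.inl (Or.inl (Or.inl (h1 hz)))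
        · exact Or.inl (Or.inl (Or.inr hz))
        · exact Or.inl (Or.inr hz)
        · exact Or.inr hz
        · exact Or.inl (Or.inl (Or.inl (h5 hz)))
    · refine ⟨_, isSimpleArc_glue_five hγc hγi hs₁0 h hs₀1 (hγs₁.symm ▸ hQR.symm) hM.symm
        (hγs₀.symm ▸ hPL.symm) (hγη.symm ▸ hγs₁.symm ▸ hQη) (hγη.symm ▸ hγs₀.symm ▸ hPη)
        (hγη.symm ▸ hηdiam) (fun z hz => hMQ ⟨hz.2, hz.1⟩) (fun z hz => hPM ⟨hz.2, hz.1⟩) hPQ.symm,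
        ?_, ?_⟩
      · intro z hz; exact Or.inl (Or.inl (Or.inr hz))
      · have h1 : γ '' Icc 0 s₁ ⊆ η := hγη ▸ image_mono (Icc_subset_Icc le_rfl hs₁1.le)
        have h5 : γ '' Icc s₀ 1 ⊆ η := hγη ▸ image_mono (Icc_subset_Icc hs₀0.le le_rfl)
        rintro z ((((hz | hz) | hz) | hz) | hz)
        · exact Or.inl (Or.inl (Or.inl (h1 hz)))
        · exact Or.inr hz
        · exact Or.inl (Or.inr hz)
        · exact Or.inl (Or.inl (Or.inr hz))
        · exact Or.inl (Or.inl (Or.inl (h5 hz)))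
  -- conclusion
  obtain ⟨L, hL, hdiamL, hLsub⟩ := key
  have hLsub' : L ⊆ O ∪ diam ∪ {x 0, x 1} := by
    intro z hz
    rcases hLsub hz with ((hz | hz | hz) | hz) | hz | hz
    · rcases hηOx hz with h | h
      · exact Or.inl (Or.inl h)
      · exact Or.inr h
    · exact Or.inl (Or.inl (hα'O hz))
    · rcases hdockLsubO (hcLsub hz) with h | h
      · exact Or.inl (Or.inl h)
      · exact Or.inl (Or.inr (h ▸ htLdiam))
    · exact Or.inl (Or.inr hz)
    · rcases hdockRsubO (hcRsub hz) with h | h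
      · exact Or.inl (Or.inl h)
      · exact Or.inl (Or.inr (h ▸ htRdiam))
    · exact Or.inl (Or.inl (hβ'O hz))
  refine ⟨L, ⟨hγ0 ▸ hγ1 ▸ hL, hx0, hx1, hx01, ?_⟩, hdiamL, hLsub', ?_⟩
  · rintro z ⟨hz, hzx⟩
    rcases hLsub' hz with (h | h) | h
    · exact hOJ h
    · exact hballJ (hdiam_ball h)
    · exact (hzx h).elim
  · refine Subset.antisymm ?_ fun z hz => ⟨hdiamL hz, hdiam_ball hz⟩
    rintro z ⟨hz, hzb⟩
    rcases hLsub' hz with (h | h) | h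
    · exact (Set.disjoint_left.1 hOball h hzb).elim
    · exact h
    · rcases h with rfl | h
      · exact (hxball 0 hzb).elim
      · exact (hxball 1 (mem_singleton_iff.1 h ▸ hzb)).elim

end Summit.CriticalPhenomena.SAWScalingLimit.Theorems.ObservableToSLER.Squeeze

end
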